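import Mathlib.Analysis.InnerProductSpace.PiL2
import Mathlib.Geometry.Manifold.IsManifold.Basic
import Literature.Analysis.Calculus.ImmersionEstimates
import Literature.Analysis.Convexity.BendEstimates
import Literature.Analysis.Convexity.LatticeRefinement
import Literature.Analysis.Convexity.PLMap
import HarnessLib

/-!
# Whitehead triangulations, stage preliminaries: zones and simplex constants

Set-up for one step of the inductive construction of a smooth triangulation (Munkres (1966),
§10): a finite coordinate complex `K` in `ℝᴺ`, a map `f : ℝᴺ → M` into a topological space,
injective and simplexwise continuous on `K.space`, and a chart `e` of `M` (an
`OpenPartialHomeomorph M (𝔼 n)`).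

* `zone K f e R` — the part of `K.space` mapped by `f` into `e.symm '' R`; for compact `R` inside
  `e.target` it is compact (`isCompact_zone`) and described by `e (f x) ∈ R` (`mem_zone_iff`);
* `exists_simplex_constants` — for a top simplex `s` with a smooth model `G` of `e ∘ f` near
  `convexHull s ∩ f ⁻¹' e.source` whose derivative is injective on the direction space, and a
  compact `R ⊆ e.target`: on a compact thickening of `Q = convexHull s ∩ zone R` we get the
  constants `B₁` (bound and Lipschitz constant of `G`), `B₂` (Lipschitz constant of `G'`),
  `μ` (`μ ‖u‖ ≤ ‖G'(x) u‖` on the direction space) and `μ'` (`μ' ‖x - y‖ ≤ ‖G x - G y‖` on `Q`)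
  — `Literature.Analysis.Convexity.exists_constants_of_contDiffOn` and
  `Literature.Analysis.Calculus.exists_pos_forall_mul_norm_sub_le`;
* `exists_pos_forall_of_finite` / `exists_forall_le_of_finite` — uniformising finitely many
  positive (resp. upper-bound) constants.

No named facts are introduced.
-/

open Set Function Metric
open scoped Topology NNReal ContDiff Manifold

noncomputable section

namespace Literature.Topology.FourManifolds

open Literature.Analysis.Convexity Literature.Analysis.Calculus

local notation "𝔼 " n:arg => EuclideanSpace ℝ (Fin n)

/-! ### Uniformising finitely many constants -/

section Finite

/-- Finitely many positive constants with antitone properties have a common positive lower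
value. [folklore] -/
theorem exists_pos_forall_of_finite {α : Type*} {S : Set α} (hS : S.Finite) {P : α → ℝ → Prop}
    (hP : ∀ a ∈ S, ∀ r r', 0 < r' → r' ≤ r → P a r → P a r') (h : ∀ a ∈ S, ∃ r > 0, P a r) :
    ∃ r > 0, ∀ a ∈ S, P a r := by
  classical
  choose! r hr hPr using h
  rcases S.eq_empty_or_nonempty with rfl | hne
  · exact ⟨1, one_pos, fun a ha => ha.elim⟩
  · have hne' : (hS.toFinset.image r).Nonempty := (hS.toFinset_nonempty.2 hne).image r
    refine ⟨(hS.toFinset.image r).min' hne', ?_, fun a ha => ?_⟩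
    · obtain ⟨a, ha, h⟩ := Finset.mem_image.1 ((hS.toFinset.image r).min'_mem hne')
      rw [← h]; exact hr a (hS.mem_toFinset.1 ha)
    · have hle : (hS.toFinset.image r).min' hne' ≤ r a :=
        Finset.min'_le _ _ (Finset.mem_image_of_mem r (hS.mem_toFinset.2 ha))
      have hpos : 0 < (hS.toFinset.image r).min' hne' := by
        obtain ⟨a', ha', h⟩ := Finset.mem_image.1 ((hS.toFinset.image r).min'_mem hne')
        rw [← h]; exact hr a' (hS.mem_toFinset.1 ha')
      exact hP a ha (r a) _ hpos hle (hPr a ha)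

/-- Finitely many real constants have a common upper bound. [folklore] -/
theorem exists_forall_le_of_finite {α : Type*} {S : Set α} (hS : S.Finite) (B : α → ℝ) :
    ∃ C : ℝ, 0 ≤ C ∧ ∀ a ∈ S, B a ≤ C := by
  classical
  refine ⟨∑ a ∈ hS.toFinset, |B a|, Finset.sum_nonneg fun _ _ => abs_nonneg _, fun a ha => ?_⟩
  exact (le_abs_self _).trans
    (Finset.single_le_sum (f := fun a => |B a|) (fun _ _ => abs_nonneg _) (hS.mem_toFinset.2 ha))

end Finite

/-! ### Zones -/

section Zone

variable {n N : ℕ} {M : Type*} [TopologicalSpace M]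

/-- The *zone* of a subset `R` of the chart target: the points of `K.space` which `f` maps into
`e.symm '' R`. [folklore] -/
def zone (K : Geometry.SimplicialComplex ℝ (Fin N → ℝ)) (f : (Fin N → ℝ) → M)
    (e : OpenPartialHomeomorph M (𝔼 n)) (R : Set (𝔼 n)) : Set (Fin N → ℝ) :=
  K.space ∩ f ⁻¹' (e.symm '' R)

variable {K : Geometry.SimplicialComplex ℝ (Fin N → ℝ)} {f : (Fin N → ℝ) → M}
  {e : OpenPartialHomeomorph M (𝔼 n)} {R R' : Set (𝔼 n)}

/-- Membership in a zone, for `R ⊆ e.target`. [folklore] -/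
theorem mem_zone_iff (hR : R ⊆ e.target) {x : Fin N → ℝ} :
    x ∈ zone K f e R ↔ x ∈ K.space ∧ f x ∈ e.source ∧ e (f x) ∈ R := by
  constructor
  · rintro ⟨hxK, y, hy, hyx⟩
    refine ⟨hxK, ?_, ?_⟩
    · rw [← hyx]; exact e.map_target (hR hy)
    · rw [← hyx, e.right_inv (hR hy)]; exact hy
  · rintro ⟨hxK, hsrc, hy⟩
    exact ⟨hxK, e (f x), hy, e.left_inv hsrc⟩

/-- Zones lie in the underlying space. [folklore] -/
theorem zone_subset_space : zone K f e R ⊆ K.space := inter_subset_left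

/-- Zones are monotone. [folklore] -/
theorem zone_mono (h : R ⊆ R') : zone K f e R ⊆ zone K f e R' :=
  inter_subset_inter_right _ (preimage_mono (image_mono h))

/-- Points of a zone are mapped into the chart source. [folklore] -/
theorem mem_source_of_mem_zone (hR : R ⊆ e.target) {x : Fin N → ℝ} (hx : x ∈ zone K f e R) :
    f x ∈ e.source := ((mem_zone_iff hR).1 hx).2.1

/-- **Zones of compact sets are compact** (`M` Hausdorff, `f` continuous on the compact underlying
space of the finite complex). [folklore] -/
theorem isCompact_zone [T2Space M] (hfin : K.faces.Finite)
    (hcont : ∀ s ∈ K.faces, ContinuousOn f (convexHull ℝ (s : Set (Fin N → ℝ)))) (hRc : IsCompact R)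
    (hR : R ⊆ e.target) : IsCompact (zone K f e R) := by
  have hK : IsCompact K.space := isCompact_space_of_finite hfin
  have hfc : ContinuousOn f K.space := continuousOn_space_of_forall hfin hcont
  have himg : IsCompact (e.symm '' R) := hRc.image_of_continuousOn (e.continuousOn_symm.mono hR)
  exact hK.of_isClosed_subset (hfc.preimage_isClosed_of_isClosed hK.isClosed himg.isClosed)
    inter_subset_left

end Zone

/-! ### Constants of a top simplex -/

section Constants

variable {n N : ℕ} {M : Type*} [TopologicalSpace M]
  {K : Geometry.SimplicialComplex ℝ (Fin N → ℝ)} {f : (Fin N → ℝ) → M}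
  {e : OpenPartialHomeomorph M (𝔼 n)}

/-- Differences of points of a closed simplex lie in the direction space. [folklore] -/
theorem sub_mem_vectorSpan_of_mem_convexHull {s : Finset (Fin N → ℝ)} {x y : Fin N → ℝ}
    (hx : x ∈ convexHull ℝ (s : Set (Fin N → ℝ))) (hy : y ∈ convexHull ℝ (s : Set (Fin N → ℝ))) :
    x - y ∈ vectorSpan ℝ (s : Set (Fin N → ℝ)) := by
  rw [← direction_affineSpan]
  exact AffineSubspace.vsub_mem_direction (convexHull_subset_affineSpan _ hx)
    (convexHull_subset_affineSpan _ hy)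

/-- **Constants of a top simplex.** Let `G` be a `C^∞` model of `e ∘ f` on an open set
`O ⊇ convexHull s ∩ f ⁻¹' e.source` whose derivative is injective on the direction space of `s`
there, let `f` be injective on `K.space ⊇ convexHull s`, and let `R ⊆ e.target` be compact with
compact zone. Then on a compact thickening of `Q = convexHull s ∩ zone K f e R` inside `O`: the
derivative of `G` is bounded by `B₁`, `G` is `B₁`-Lipschitz and `G'` is `B₂`-Lipschitz on convex
subsets, `μ ‖u‖ ≤ ‖G'(x) u‖` for `x ∈ Q` and directions `u`, and `μ' ‖x - y‖ ≤ ‖G x - G y‖` on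
`Q`. [folklore] -/
theorem exists_simplex_constants {s : Finset (Fin N → ℝ)}
    (hinj : InjOn f K.space) {R : Set (𝔼 n)} (hR : R ⊆ e.target) (hZ : IsCompact (zone K f e R))
    {O : Set (Fin N → ℝ)} (hO : IsOpen O)
    (hsO : convexHull ℝ (s : Set (Fin N → ℝ)) ∩ f ⁻¹' e.source ⊆ O) {G : (Fin N → ℝ) → 𝔼 n}
    (hG : ContDiffOn ℝ ∞ G O)
    (hGf : EqOn (e ∘ f) G (convexHull ℝ (s : Set (Fin N → ℝ)) ∩ f ⁻¹' e.source))
    (hGinj : ∀ x ∈ convexHull ℝ (s : Set (Fin N → ℝ)) ∩ f ⁻¹' e.source,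
      ∀ u ∈ vectorSpan ℝ (s : Set (Fin N → ℝ)), fderiv ℝ G x u = 0 → u = 0) :
    ∃ ρ > 0, ∃ B₁ B₂ : ℝ≥0, ∃ μ > 0, ∃ μ' > 0,
      cthickening ρ (convexHull ℝ (s : Set (Fin N → ℝ)) ∩ zone K f e R) ⊆ O ∧
      (∀ x ∈ cthickening ρ (convexHull ℝ (s : Set (Fin N → ℝ)) ∩ zone K f e R), ‖fderiv ℝ G x‖ ≤ B₁) ∧
      (∀ S, Convex ℝ S → S ⊆ cthickening ρ (convexHull ℝ (s : Set (Fin N → ℝ)) ∩ zone K f e R) →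
        LipschitzOnWith B₁ G S ∧ LipschitzOnWith B₂ (fderiv ℝ G) S) ∧
      (∀ x ∈ convexHull ℝ (s : Set (Fin N → ℝ)) ∩ zone K f e R,
        ∀ u ∈ vectorSpan ℝ (s : Set (Fin N → ℝ)), μ * ‖u‖ ≤ ‖fderiv ℝ G x u‖) ∧
      (∀ x ∈ convexHull ℝ (s : Set (Fin N → ℝ)) ∩ zone K f e R,
        ∀ y ∈ convexHull ℝ (s : Set (Fin N → ℝ)) ∩ zone K f e R, μ' * ‖x - y‖ ≤ ‖G x - G y‖) := by
  set Q : Set (Fin N → ℝ) := convexHull ℝ (s : Set (Fin N → ℝ)) ∩ zone K f e R with hQ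
  -- `Q` is compact and lies in `convexHull s ∩ f ⁻¹' e.source ⊆ O`
  have hQc : IsCompact Q := hZ.inter_left (s.finite_toSet.isClosed_convexHull ℝ)
  have hQsub : Q ⊆ convexHull ℝ (s : Set (Fin N → ℝ)) ∩ f ⁻¹' e.source := fun x hx =>
    ⟨hx.1, mem_source_of_mem_zone hR hx.2⟩
  have hQO : Q ⊆ O := hQsub.trans hsO
  obtain ⟨ρ, hρ, B₁, B₂, hρO, hB₁, hLip⟩ := exists_constants_of_contDiffOn hO hG hQc hQO
  -- derivative data on `Q`
  have hcontD : ContinuousOn (fderiv ℝ G) Q := (hG.continuousOn_fderiv_of_isOpen hO (by simp)).mono hQO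
  have hstrict : ∀ x ∈ Q, HasStrictFDerivAt G (fderiv ℝ G x) x := fun x hx =>
    (hG.contDiffAt (hO.mem_nhds (hQO hx))).hasStrictFDerivAt (by simp)
  have hinjD : ∀ x ∈ Q, ∀ u ∈ vectorSpan ℝ (s : Set (Fin N → ℝ)), fderiv ℝ G x u = 0 → u = 0 :=
    fun x hx => hGinj x (hQsub hx)
  obtain ⟨μ, hμ, hμle⟩ := exists_pos_forall_mul_norm_le_norm_apply hQc hcontD
    (vectorSpan ℝ (s : Set (Fin N → ℝ))) hinjD
  -- `G` is injective on `Q` (it is `e ∘ f` there)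
  have hGinjQ : InjOn G Q := fun x hx y hy hxy => by
    have hx' := hQsub hx
    have hy' := hQsub hy
    rw [← hGf hx', ← hGf hy'] at hxy
    have : f x = f y := e.injOn hx'.2 hy'.2 hxy
    exact hinj (zone_subset_space hx.2) (zone_subset_space hy.2) this
  obtain ⟨μ', hμ', hμ'le⟩ := exists_pos_forall_mul_norm_sub_le hQc
    (Dir := vectorSpan ℝ (s : Set (Fin N → ℝ)))
    (fun y hy y' hy' => sub_mem_vectorSpan_of_mem_convexHull hy.1 hy'.1) hstrict hcontD hinjD hGinjQ
  exact ⟨ρ, hρ, B₁, B₂, μ, hμ, μ', hμ', hρO, hB₁, hLip, hμle, fun x hx y hy => hμ'le x hx y hy⟩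

end Constants

end Literature.Topology.FourManifolds
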